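import Summits.RiemannHypothesis.RiemannHypothesis.Theorems.GroundBartaEvenWinsBeyondArchDeflationPSD
import HarnessLib

/-!
# RiemannHypothesis / GroundBarta — rung 4 (`EvenWinsBeyondArch`, stmt-RiemannHypothesis-18807 / 18085):
# the deflated Temple L-side, XII b — diagonal scaling of the PSD certificate

Helper file (`--supports`), RH-free, no definitions, no named facts.  Prover A, speedrun unit `sr-gb-rung-a` (gen 2).

`dt_psd_of_certificate` (file XII) asks for a UNIFORM Gershgorin budget `Σ_j E_ij ≤ δ` on the enclosure widths.  The
matrix of the window cells is violently graded: with `G`-orthonormal Ritz vectors its diagonal runs from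
`P₁₁ ≈ (β−λ)(ρ₁−λ) − σ₁² ≈ 3·10⁻¹²` (ground-state-like vector) to `P₆₆ ≈ 0.3`, so a uniform budget would force EVERY entry —
including the `L²` norms of the window images of the roughest vectors — to absolute precision `10⁻¹³`.  Positive
semi-definiteness is invariant under `M ↦ S M S` for a positive diagonal `S` (`dt_psd_of_scaled`); applying file XII to the
scaled matrix (`dt_psd_of_scaledCertificate`, typically `s_i = P_ii^{-1/2}` rounded) turns the budget into a RELATIVE one:
entry `(i, j)` is needed to precision `≈ δ·(P_ii P_jj)^{1/2}`, i.e. `10⁻¹³` for `(1,1)` only, `10⁻¹⁰…10⁻⁷` for the rest of the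
first row, and `10⁻²…10⁻⁶` elsewhere — which is what makes the Taylor-model layer for the window images affordable.
[cite: Rump2006PosDef, §2 (scaling before the perturbation argument)]
-/

set_option linter.dupNamespace false

noncomputable section

open Finset
open scoped BigOperators

namespace Summit.RiemannHypothesis.RiemannHypothesis.Theorems.EvenWinsBeyondArch

/-- **PSD is invariant under positive diagonal scaling**: if `Σ α_i α_j (s_i s_j M_ij) ≥ 0` for all `α` and no `s_i`
vanishes, then `Σ α_i α_j M_ij ≥ 0` for all `α`. [folklore] -/
theorem dt_psd_of_scaled {k : ℕ} (M : Fin k → Fin k → ℝ) (s : Fin k → ℝ) (hs : ∀ i, s i ≠ 0)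
    (h : ∀ α : Fin k → ℝ, 0 ≤ ∑ i, ∑ j, α i * α j * (s i * s j * M i j)) (α : Fin k → ℝ) :
    0 ≤ ∑ i, ∑ j, α i * α j * M i j := by
  have h' := h fun i ↦ α i / s i
  have heq : ∑ i, ∑ j, α i / s i * (α j / s j) * (s i * s j * M i j) = ∑ i, ∑ j, α i * α j * M i j :=
    Finset.sum_congr rfl fun i _ ↦ Finset.sum_congr rfl fun j _ ↦ by
      field_simp [hs i, hs j]
  linarith [heq ▸ h']

/-- **The scaled PSD certificate.**  Rational data as in `dt_psd_of_certificate`, but the enclosures, the margin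
factorisation and the Gershgorin budget refer to the diagonally scaled matrix `s_i s_j M_ij` (`s_i > 0` rational):
`|s_i s_j M_ij − P_ij| ≤ E_ij`, `Σ_j E_ij ≤ δ`, `Σ_i E_ij ≤ δ`, `P = δ·1 + Lᵀ diag(D) L`, `D ≥ 0`.  Then
`∀ α, 0 ≤ Σ_i Σ_j α_i α_j M_ij` — the hypothesis `hPSD` of `dt_weil{Even,Odd}GroundEnergy_ge_of_ritz`.
[cite: Rump2006PosDef, §2 (perturbation argument after scaling)] -/
theorem dt_psd_of_scaledCertificate {k m : ℕ} (M : Fin k → Fin k → ℝ) (s : Fin k → ℚ) (hs : ∀ i, 0 < s i)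
    (P E : Fin k → Fin k → ℚ) (D : Fin m → ℚ) (L : Fin m → Fin k → ℚ) (δ : ℚ)
    (hE : ∀ i j, |(s i : ℝ) * s j * M i j - P i j| ≤ E i j) (hrow : ∀ i, ∑ j, E i j ≤ δ)
    (hcol : ∀ j, ∑ i, E i j ≤ δ) (hD : ∀ r, 0 ≤ D r)
    (hP : ∀ i j, P i j = δ * (if i = j then 1 else 0) + ∑ r, D r * L r i * L r j) (α : Fin k → ℝ) :
    0 ≤ ∑ i, ∑ j, α i * α j * M i j :=
  dt_psd_of_scaled M (fun i ↦ (s i : ℝ)) (fun i ↦ by exact_mod_cast (hs i).ne')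
    (dt_psd_of_certificate (fun i j ↦ (s i : ℝ) * s j * M i j) P E D L δ hE hrow hcol hD hP) α

end Summit.RiemannHypothesis.RiemannHypothesis.Theorems.EvenWinsBeyondArch

end
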